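import Mathlib
import HarnessLib
import Summits.CriticalPhenomena.SAWScalingLimit.Theses.SAWDevelopingMap

/-!
# Sketch — first lemmas of three crux ideas for `InteriorFlattening` (stmt-CriticalPhenomena-8297)

Each `def … : Prop` is the FIRST CHECKABLE STATEMENT of one idea card (`Ideas/<slug>.md`);
nothing is proved here, the point is that the statements elaborate over existing declarations.
-/

namespace Summit.CriticalPhenomena.SAWScalingLimit.Cruxes.InteriorFlattening.Sketch

open Literature.Probability.RandomPlanarGeometry.SAW Literature.Probability.LatticeModels

/-- Card `equilateral-sides-pair-measure`, First lemma (exact, provable now):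
at every vertex of a simply connected domain, in the DCS orientation (`D = 0`, Lemma 1), the
monopole `M = ΣF` and the Beltrami mode `B` satisfy the two MODULUS identities
`‖M‖² + ‖B‖² = 3 Σᵢ ‖F(pᵢ)‖²` and `‖M‖·‖B‖ = 3 ‖Σᵢ ωⁱ ‖F(pᵢ)‖²‖`; hence
`|μ| + |μ|⁻¹ = Σ‖F(pᵢ)‖² / ‖Σ ωⁱ‖F(pᵢ)‖²‖` is a function of the three moduli alone
(the image triangle of the developing map has side lengths ∝ ‖F(pᵢ)‖: equal sides ⇔ μ ∈ {0, ∞}). -/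
def EquilateralSidesIdentity : Prop :=
  ∀ (Λ : Finset HexVertex), hexDomainSimplyConnected Λ → ∀ a ∈ hexDomainBoundary Λ, ∀ v ∈ Λ,
    ∀ w₀ w₁ w₂ : HexVertex, hexGraph.Adj v w₀ → hexGraph.Adj v w₁ → hexGraph.Adj v w₂ →
      w₀ ≠ w₁ → w₁ ≠ w₂ → w₀ ≠ w₂ →
      let F : Sym2 HexVertex → ℂ := hexParafermionicObservable Λ a hexCriticalFugacity (5 / 8)
      let ω : ℂ := Complex.exp (2 * Real.pi * Complex.I / 3)
      let M : ℂ := F s(v, w₀) + F s(v, w₁) + F s(v, w₂)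
      let B : ℂ := F s(v, w₀) + ω * F s(v, w₁) + ω ^ 2 * F s(v, w₂)
      let D : ℂ := F s(v, w₀) + ω ^ 2 * F s(v, w₁) + ω * F s(v, w₂)
      D = 0 →
        ‖M‖ ^ 2 + ‖B‖ ^ 2 = 3 * (‖F s(v, w₀)‖ ^ 2 + ‖F s(v, w₁)‖ ^ 2 + ‖F s(v, w₂)‖ ^ 2) ∧
        ‖M‖ * ‖B‖ = 3 * ‖((‖F s(v, w₀)‖ ^ 2 : ℝ) : ℂ) + ω * ((‖F s(v, w₁)‖ ^ 2 : ℝ) : ℂ) +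
          ω ^ 2 * ((‖F s(v, w₂)‖ ^ 2 : ℝ) : ℂ)‖

/-- Card `equilateral-sides-pair-measure`, the TRANSFER target it exposes (conditional form):
no fold at `v` (`‖B‖ ≤ k‖M‖`, `k < 1`) plus near-equality of the three moduli forces flatness
quantitatively: if `‖F(pᵢ)‖² ∈ [m(1-η), m(1+η)]` then `‖B‖ ≤ (2η/(1-k)) ‖M‖` (crude constant).
Elementary from `EquilateralSidesIdentity`; stated to fix the shape of the reduction. -/
def EquiModulusForcesFlat : Prop :=
  ∀ (k η m : ℝ), 0 ≤ k → k < 1 → 0 ≤ η → η < 1 / 2 → 0 < m →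
  ∀ (Λ : Finset HexVertex), hexDomainSimplyConnected Λ → ∀ a ∈ hexDomainBoundary Λ, ∀ v ∈ Λ,
    ∀ w₀ w₁ w₂ : HexVertex, hexGraph.Adj v w₀ → hexGraph.Adj v w₁ → hexGraph.Adj v w₂ →
      w₀ ≠ w₁ → w₁ ≠ w₂ → w₀ ≠ w₂ →
      let F : Sym2 HexVertex → ℂ := hexParafermionicObservable Λ a hexCriticalFugacity (5 / 8)
      let ω : ℂ := Complex.exp (2 * Real.pi * Complex.I / 3)
      let M : ℂ := F s(v, w₀) + F s(v, w₁) + F s(v, w₂)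
      let B : ℂ := F s(v, w₀) + ω * F s(v, w₁) + ω ^ 2 * F s(v, w₂)
      let D : ℂ := F s(v, w₀) + ω ^ 2 * F s(v, w₁) + ω * F s(v, w₂)
      D = 0 → ‖B‖ ≤ k * ‖M‖ →
      (∀ w ∈ ({w₀, w₁, w₂} : Finset HexVertex), m * (1 - η) ≤ ‖F s(v, w)‖ ^ 2 ∧ ‖F s(v, w)‖ ^ 2 ≤ m * (1 + η)) →
        ‖B‖ ≤ (2 * η / (1 - k)) * ‖M‖

/-- Card `access-arc-cone-bound`, First lemma (exact, provable now): the CONE BOUND — if every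
self-avoiding walk from the root `a` to the three mid-edges of `v` has total winding in a window
of length `L < 8π/5`, the monopole cannot interfere destructively:
`‖ΣᵢF(pᵢ)‖ ≥ cos(5L/16) · Σᵢ Σ_γ x_c^{ℓ(γ)}` (all phases `e^{-i(5/8)W}` lie in an arc of opening
`(5/8)L < π`). This is the single-sheet / narrow-access half of the anti-interference statement. -/
def ConeBound : Prop :=
  ∀ (Λ : Finset HexVertex) (a : Sym2 HexVertex) (v w₀ w₁ w₂ : HexVertex) (W₀ L : ℝ),
    0 ≤ L → L < 8 * Real.pi / 5 →
    (∀ w ∈ ({w₀, w₁, w₂} : Finset HexVertex), ∀ γ : HexMidEdgeSAW Λ a s(v, w),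
        W₀ ≤ γ.winding ∧ γ.winding ≤ W₀ + L) →
      let F : Sym2 HexVertex → ℂ := hexParafermionicObservable Λ a hexCriticalFugacity (5 / 8)
      Real.cos (5 * L / 16) *
          (∑ w ∈ ({w₀, w₁, w₂} : Finset HexVertex), ∑ γ : HexMidEdgeSAW Λ a s(v, w),
            hexCriticalFugacity ^ γ.length) ≤
        ‖∑ w ∈ ({w₀, w₁, w₂} : Finset HexVertex), F s(v, w)‖

/-- Card `liouville-local-limits`, First lemma (provable now): LATTICE HARNACK FROM NO-FOLD — at a
vertex where the Beltrami quotient is `≤ k < 1` (in the DCS orientation), the three mid-edge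
moduli are comparable with the quasiconformal constant `K = (1+k)/(1-k)`:
`‖F(p₀)‖ ≤ K ‖F(p₁)‖`. Chained along paths this gives local boundedness of the normalised
observable on every lattice ball, i.e. precompactness of lattice-scale local limits. -/
def NoFoldHarnack : Prop :=
  ∀ (k : ℝ), 0 ≤ k → k < 1 →
  ∀ (Λ : Finset HexVertex) (a : Sym2 HexVertex) (v w₀ w₁ w₂ : HexVertex),
    hexGraph.Adj v w₀ → hexGraph.Adj v w₁ → hexGraph.Adj v w₂ → w₀ ≠ w₁ → w₁ ≠ w₂ → w₀ ≠ w₂ →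
      let F : Sym2 HexVertex → ℂ := hexParafermionicObservable Λ a hexCriticalFugacity (5 / 8)
      let ω : ℂ := Complex.exp (2 * Real.pi * Complex.I / 3)
      let M : ℂ := F s(v, w₀) + F s(v, w₁) + F s(v, w₂)
      let B : ℂ := F s(v, w₀) + ω * F s(v, w₁) + ω ^ 2 * F s(v, w₂)
      let D : ℂ := F s(v, w₀) + ω ^ 2 * F s(v, w₁) + ω * F s(v, w₂)
      D = 0 → ‖B‖ ≤ k * ‖M‖ → ‖F s(v, w₀)‖ ≤ ((1 + k) / (1 - k)) * ‖F s(v, w₁)‖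

/-- Card `liouville-local-limits`, the TRANSFER target C⁺ (qualitative Liouville form, stated with
the route's own crux as hypothesis so that the dependence is explicit): under `NoFoldBound`,
`InteriorFlattening` is implied by — and by a compactness argument equivalent to — the statement
that every lattice-scale pointwise limit of root-normalised observables along deep vertices is
orientation-free at the origin vertex. Here written in the ε-free sequential form the card argues
from: for every sequence of (domain, root, deep vertex, labelling) with depth → ∞ whose normalised
triples converge, the limit triple is flat. -/
def LiouvilleAtTheOrigin : Prop :=
  Summit.CriticalPhenomena.SAWScalingLimit.Theses.SAWDevelopingMap.NoFoldBound →
  ∀ (Λ : ℕ → Finset HexVertex) (a : ℕ → Sym2 HexVertex) (v w₀ w₁ w₂ : ℕ → HexVertex)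
    (t₀ t₁ t₂ : ℂ),
    (∀ n, hexDomainSimplyConnected (Λ n) ∧ a n ∈ hexDomainBoundary (Λ n) ∧ v n ∈ Λ n ∧
      hexGraph.Adj (v n) (w₀ n) ∧ hexGraph.Adj (v n) (w₁ n) ∧ hexGraph.Adj (v n) (w₂ n) ∧
      w₀ n ≠ w₁ n ∧ w₁ n ≠ w₂ n ∧ w₀ n ≠ w₂ n ∧
      (∀ w : HexVertex, dist (hexCenter w) (hexCenter (v n)) ≤ n → w ∈ Λ n)) →
    ∀ F : ℕ → Sym2 HexVertex → ℂ,
      (F = fun n => hexParafermionicObservable (Λ n) (a n) hexCriticalFugacity (5 / 8)) →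
    ((∀ n, F n s(v n, w₀ n) + F n s(v n, w₁ n) + F n s(v n, w₂ n) ≠ 0) ∧
      Filter.Tendsto (fun n => F n s(v n, w₀ n) / (F n s(v n, w₀ n) + F n s(v n, w₁ n) + F n s(v n, w₂ n)))
        Filter.atTop (nhds t₀) ∧
      Filter.Tendsto (fun n => F n s(v n, w₁ n) / (F n s(v n, w₀ n) + F n s(v n, w₁ n) + F n s(v n, w₂ n)))
        Filter.atTop (nhds t₁) ∧
      Filter.Tendsto (fun n => F n s(v n, w₂ n) / (F n s(v n, w₀ n) + F n s(v n, w₁ n) + F n s(v n, w₂ n)))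
        Filter.atTop (nhds t₂)) →
    let ω : ℂ := Complex.exp (2 * Real.pi * Complex.I / 3)
    t₀ + ω * t₁ + ω ^ 2 * t₂ = 0 ∨ t₀ + ω ^ 2 * t₁ + ω * t₂ = 0 →
      t₀ + ω * t₁ + ω ^ 2 * t₂ = 0 ∧ t₀ + ω ^ 2 * t₁ + ω * t₂ = 0

/-- Sanity: the Liouville form implies the crux under (K) is the card's claim (compactness); the
converse direction (crux ⇒ Liouville) is immediate. Recorded as a Prop, not proved here. -/
def LiouvilleGivesCrux : Prop :=
  LiouvilleAtTheOrigin →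
    Summit.CriticalPhenomena.SAWScalingLimit.Theses.SAWDevelopingMap.NoFoldBound →
      Summit.CriticalPhenomena.SAWScalingLimit.Theses.SAWDevelopingMap.InteriorFlattening

end Summit.CriticalPhenomena.SAWScalingLimit.Cruxes.InteriorFlattening.Sketch
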